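import Literature.Probability.RandomPlanarGeometry.HexSAWStripWidthThreeContactVariance
import HarnessLib

/-!
# The width-three strip at criticality: a weak law for the surface contacts with an explicit `1/n` rate —
# `n·P_n(|#top/n − θ₃| ≥ ε) ≤ σ₃²/ε² + o(1)` (`θ₃ = c/2`, `σ₃² = sigmaSqThree`) (module «WIDTH-THREE CONTACT CHEBYSHEV RATE»)

Topic `Literature/Probability/RandomPlanarGeometry` (continues «WIDTH-THREE CONTACT VARIANCE» — `W3.varTopThree`, `W3.meanTopThree`, `W3.tendsto_varTopThree_div_hatLen`,
`W3.tendsto_meanTopThree_div_hatLen`, `W3.sigmaSqThree`, `W3.cThree` — and «WIDTH-THREE CONTACT ASYMPTOTICS» (`W3.limDThree_pos`, `W3.tendsto_hatD_three_succ`); the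
width-two twin is «WIDTH-TWO CONTACT CHEBYSHEV RATE» `HexSAWStripWidthTwoContactChebyshev.lean` (a-p2 g27), whose proof is followed line by line).  Lane «pcv-sawmu»
(CriticalPhenomena venture), a-p2 g29.  Setting: W. Feller I (1968) IX.6 (Chebyshev), XIII.6; H. Duminil-Copin, A. Hammond, CMP 324 (2013) §2.2.  Nothing below is printed.

## What is proved (namespace `…SAW.HV.W3`, `y₃ = stripYT 3`, `n_k = hatLen k a b = 2k + χ_a − χ_b`)
* `sum_sq_sub_mul_wD_three`, `sum_sq_sub_mean_wD_three`, `sum_filter_wD_le_sq_div_three` (Chebyshev on the finite weighted sum), `eventually_hatD_three_pos`,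
  `tendsto_meanTopThree_sub_div_hatLen` (`(meanTopThree − (c/2)·n_k)/n_k → 0`).
* ★★★ **`widthThree_contacts_deviation_rate`** — for every `ε > 0`, all `a, b` and every `η > σ₃²/ε²`, eventually
  `n_k · (Σ_{bridges a→b with n_k steps, |#top/n_k − c/2| ≥ ε} wD) / D̂(k)_{ab} ≤ η` (`c/2 = θ₃` by «CONTACT VARIANCE — CLOSED FORM»; `σ₃² = 0.27569…`):
  the deviation probability of the width-three LLN (#868) is `O(1/n)` with the explicit constant `σ₃²/ε²`.

Label: LANE THEOREM (own result of lane «pcv-sawmu», a-p2 g29, 2026-08-28; not in print).  NOT claimed: exponential bounds, a CLT.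
-/

noncomputable section

open Finset Filter Topology Matrix Literature.Probability.LatticeModels Literature.Probability.Percolation Literature.Analysis

namespace Literature.Probability.RandomPlanarGeometry.SAW

namespace HV

namespace W3

/-- The centred second moment of the contact count over the bridges `a → b` of hat index `k` is `Ĉ² − 2mĈ + m²D̂` for any centre `m`.
[cite: Feller1968, XIII.6; lane plumbing] -/
theorem sum_sq_sub_mul_wD_three (y : ℝ) (k : ℕ) (a b : Fin (2 * 3)) (m : ℝ) :
    ∑ l ∈ LUset 3 (2 * k + 1) (hatLen k a b) (a : ℕ) (b : ℕ), ((topCnt 3 l.tail : ℝ) - m) ^ 2 * wD 3 y l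
      = hatC2D y k a b - 2 * m * hatCD y k a b + m ^ 2 * hatD 3 y k a b := by
  have hD : hatD 3 y k a b = ∑ l ∈ LUset 3 (2 * k + 1) (hatLen k a b) (a : ℕ) (b : ℕ), wD 3 y l := rfl
  rw [hD, hatC2D, hatCD, Matrix.of_apply, Matrix.of_apply, Finset.mul_sum, Finset.mul_sum, ← Finset.sum_sub_distrib, ← Finset.sum_add_distrib]
  exact Finset.sum_congr rfl fun l _ => by ring

/-- With the mean as centre: `Σ (#top − meanTopThree)²·wD = D̂·varTopThree` (at `y₃`, whenever `D̂(k)_{ab} ≠ 0`). [cite: Feller1968, XIII.6; lane plumbing] -/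
theorem sum_sq_sub_mean_wD_three {k : ℕ} {a b : Fin (2 * 3)} (hD : hatD 3 (stripYT 3) k a b ≠ 0) :
    ∑ l ∈ LUset 3 (2 * k + 1) (hatLen k a b) (a : ℕ) (b : ℕ), ((topCnt 3 l.tail : ℝ) - meanTopThree k a b) ^ 2 * wD 3 (stripYT 3) l
      = hatD 3 (stripYT 3) k a b * varTopThree k a b := by
  rw [sum_sq_sub_mul_wD_three, varTopThree, meanTopThree]
  field_simp
  ring

/-- Chebyshev on the finite weighted sum (`c > 0`, `y ≥ 0`). [cite: Feller1968, IX.6 (Chebyshev's inequality); lane plumbing] -/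
theorem sum_filter_wD_le_sq_div_three {y : ℝ} (hy : 0 ≤ y) (k : ℕ) (a b : Fin (2 * 3)) (m : ℝ) {c : ℝ} (hc : 0 < c) :
    ∑ l ∈ (LUset 3 (2 * k + 1) (hatLen k a b) (a : ℕ) (b : ℕ)).filter (fun l => c ≤ |(topCnt 3 l.tail : ℝ) - m|), wD 3 y l
      ≤ (∑ l ∈ LUset 3 (2 * k + 1) (hatLen k a b) (a : ℕ) (b : ℕ), ((topCnt 3 l.tail : ℝ) - m) ^ 2 * wD 3 y l) / c ^ 2 := by
  set S := LUset 3 (2 * k + 1) (hatLen k a b) (a : ℕ) (b : ℕ) with hS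
  rw [le_div_iff₀ (by positivity), Finset.sum_mul]
  calc ∑ l ∈ S.filter (fun l => c ≤ |(topCnt 3 l.tail : ℝ) - m|), wD 3 y l * c ^ 2
      ≤ ∑ l ∈ S.filter (fun l => c ≤ |(topCnt 3 l.tail : ℝ) - m|), ((topCnt 3 l.tail : ℝ) - m) ^ 2 * wD 3 y l := by
        refine Finset.sum_le_sum fun l hl => ?_
        rw [Finset.mem_filter] at hl
        have hw := wD_nonneg 3 hy l
        have h2 : c ^ 2 ≤ ((topCnt 3 l.tail : ℝ) - m) ^ 2 := by
          calc c ^ 2 ≤ |(topCnt 3 l.tail : ℝ) - m| ^ 2 := pow_le_pow_left₀ hc.le hl.2 2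
            _ = ((topCnt 3 l.tail : ℝ) - m) ^ 2 := sq_abs _
        nlinarith
    _ ≤ ∑ l ∈ S, ((topCnt 3 l.tail : ℝ) - m) ^ 2 * wD 3 y l :=
        Finset.sum_le_sum_of_subset_of_nonneg (Finset.filter_subset _ _) fun l _ _ => mul_nonneg (sq_nonneg _) (wD_nonneg 3 hy l)

/-- `D̂(k)_{ab} > 0` eventually (it converges to `A_{ab} > 0`). [cite: Feller1968, XIII.10; lane plumbing] -/
theorem eventually_hatD_three_pos (a b : Fin (2 * 3)) : ∀ᶠ k : ℕ in atTop, 0 < hatD 3 (stripYT 3) k a b := by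
  have h := (tendsto_hatD_three_succ a b).eventually (eventually_gt_nhds (limDThree_pos a b))
  rw [Filter.eventually_atTop] at h ⊢
  obtain ⟨N, hN⟩ := h
  exact ⟨N + 1, fun k hk => by obtain ⟨m, rfl⟩ : ∃ m, k = m + 1 := ⟨k - 1, by omega⟩; exact hN m (by omega)⟩

/-- The centring error per step vanishes: `(meanTopThree k a b − (c/2)·n_k)/n_k → 0`. [cite: Feller1968, XIII.6; lane plumbing] -/
theorem tendsto_meanTopThree_sub_div_hatLen (a b : Fin (2 * 3)) :
    Tendsto (fun k : ℕ => (meanTopThree k a b - cThree / 2 * ((hatLen k a b : ℤ) : ℝ)) / ((hatLen k a b : ℤ) : ℝ)) atTop (𝓝 0) := by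
  set c : ℝ := ((lchi a : ℤ) : ℝ) - ((lchi b : ℤ) : ℝ) with hc
  have hL : ∀ k : ℕ, ((hatLen k a b : ℤ) : ℝ) = 2 * (k : ℝ) + c := fun k => by rw [hc, hatLen]; push_cast; ring
  have hpos : ∀ᶠ k : ℕ in atTop, ((hatLen k a b : ℤ) : ℝ) ≠ 0 := by
    have hden : Tendsto (fun k : ℕ => ((hatLen k a b : ℤ) : ℝ)) atTop atTop := by
      simp_rw [hL]; exact (tendsto_natCast_atTop_atTop.const_mul_atTop two_pos).atTop_add tendsto_const_nhds
    exact (hden.eventually_gt_atTop 0).mono fun k hk => hk.ne'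
  have h := (tendsto_meanTopThree_div_hatLen a b).sub_const (cThree / 2)
  rw [sub_self] at h
  refine h.congr' ?_
  filter_upwards [hpos] with k hk
  field_simp

/-- ★★★ **WEAK LAW WITH AN EXPLICIT `1/n` RATE for the surface contacts of the critical width-three strip**: for every `ε > 0`, all end levels `a, b` and
every `η > σ₃²/ε²` (`σ₃² = sigmaSqThree = 0.27569…`), eventually in the hat index `k` (with `n = hatLen k a b` steps)
`n · (Σ_{bridges a→b with n steps, |#top/n − c/2| ≥ ε} x_c^{n} y₃^{#top}) / D̂(k)_{ab} ≤ η` (`c/2 = θ₃`) — Chebyshev with the LINEAR VARIANCE LAW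
(«WIDTH-THREE CONTACT VARIANCE»); sharpens the width-three LLN of «WIDTH-THREE-DENSITY» #868 to the rate `O(1/n)` with an explicit constant.
[cite: Feller1968, XIII.6 and IX.6; DuminilCopinHammond2013, §2.2; lane «pcv-sawmu» a-p2 g29 — own result, not in print] -/
theorem widthThree_contacts_deviation_rate (a b : Fin (2 * 3)) {ε : ℝ} (hε : 0 < ε) {η : ℝ} (hη : sigmaSqThree / ε ^ 2 < η) :
    ∀ᶠ k : ℕ in atTop,
      ((hatLen k a b : ℤ) : ℝ) * (∑ l ∈ (LUset 3 (2 * k + 1) (hatLen k a b) (a : ℕ) (b : ℕ)).filter (fun l =>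
          ε ≤ |(topCnt 3 l.tail : ℝ) / ((hatLen k a b : ℤ) : ℝ) - cThree / 2|), wD 3 (stripYT 3) l) /
        hatD 3 (stripYT 3) k a b ≤ η := by
  have hy : 0 < stripYT 3 := by linarith [stripYT_three_bounds.1]
  set θ : ℝ := cThree / 2 with hθ
  set n : ℕ → ℝ := fun k => ((hatLen k a b : ℤ) : ℝ) with hn
  set β : ℕ → ℝ := fun k => (meanTopThree k a b - θ * n k) / n k with hβ
  have hv := tendsto_varTopThree_div_hatLen a b
  have hβ0 : Tendsto β atTop (𝓝 0) := tendsto_meanTopThree_sub_div_hatLen a b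
  have hden : Tendsto n atTop atTop := by
    have hL : n = fun k : ℕ => 2 * (k : ℝ) + (((lchi a : ℤ) : ℝ) - ((lchi b : ℤ) : ℝ)) := funext fun k => by
      simp only [hn, hatLen]; push_cast; ring
    rw [hL]
    exact (tendsto_natCast_atTop_atTop.const_mul_atTop two_pos).atTop_add tendsto_const_nhds
  have hg : Tendsto (fun k : ℕ => (varTopThree k a b / n k) / (ε - |β k|) ^ 2) atTop (𝓝 (sigmaSqThree / (ε - |0|) ^ 2)) := by
    refine hv.div ((tendsto_const_nhds.sub hβ0.abs).pow 2) ?_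
    rw [abs_zero, sub_zero]; positivity
  rw [abs_zero, sub_zero] at hg
  have hEv1 : ∀ᶠ k : ℕ in atTop, (varTopThree k a b / n k) / (ε - |β k|) ^ 2 < η := hg.eventually (eventually_lt_nhds hη)
  have hEv2 : ∀ᶠ k : ℕ in atTop, |β k| < ε := by
    have := hβ0.abs
    rw [abs_zero] at this
    exact this.eventually (eventually_lt_nhds hε)
  have hEv3 : ∀ᶠ k : ℕ in atTop, 0 < n k := hden.eventually_gt_atTop 0
  filter_upwards [hEv1, hEv2, hEv3, eventually_hatD_three_pos a b] with k h1 h2 h3 hD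
  set m : ℝ := meanTopThree k a b with hm
  set S := LUset 3 (2 * k + 1) (hatLen k a b) (a : ℕ) (b : ℕ) with hS
  have hc : 0 < (ε - |β k|) * n k := mul_pos (by linarith) h3
  have hsub : S.filter (fun l => ε ≤ |(topCnt 3 l.tail : ℝ) / n k - θ|) ⊆ S.filter (fun l => (ε - |β k|) * n k ≤ |(topCnt 3 l.tail : ℝ) - m|) := by
    intro l hl
    rw [Finset.mem_filter] at hl ⊢
    refine ⟨hl.1, ?_⟩
    have hnk : n k ≠ 0 := h3.ne'
    have e1 : (topCnt 3 l.tail : ℝ) - m = n k * ((topCnt 3 l.tail : ℝ) / n k - θ) - n k * β k := by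
      simp only [hβ, hm]
      field_simp
      ring
    rw [e1]
    have hA : ε * n k ≤ |n k * ((topCnt 3 l.tail : ℝ) / n k - θ)| := by
      rw [abs_mul, abs_of_pos h3, mul_comm]
      exact mul_le_mul_of_nonneg_left hl.2 h3.le
    have hB : |n k * β k| = n k * |β k| := by rw [abs_mul, abs_of_pos h3]
    have := abs_sub_abs_le_abs_sub (n k * ((topCnt 3 l.tail : ℝ) / n k - θ)) (n k * β k)
    nlinarith [hA, hB, this]
  have hcheb := sum_filter_wD_le_sq_div_three hy.le k a b m hc
  rw [sum_sq_sub_mean_wD_three hD.ne'] at hcheb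
  have hmono : ∑ l ∈ S.filter (fun l => ε ≤ |(topCnt 3 l.tail : ℝ) / n k - θ|), wD 3 (stripYT 3) l
      ≤ ∑ l ∈ S.filter (fun l => (ε - |β k|) * n k ≤ |(topCnt 3 l.tail : ℝ) - m|), wD 3 (stripYT 3) l :=
    Finset.sum_le_sum_of_subset_of_nonneg hsub fun l _ _ => wD_nonneg 3 hy.le l
  have hkey : n k * (∑ l ∈ S.filter (fun l => ε ≤ |(topCnt 3 l.tail : ℝ) / n k - θ|), wD 3 (stripYT 3) l) / hatD 3 (stripYT 3) k a b
      ≤ (varTopThree k a b / n k) / (ε - |β k|) ^ 2 := by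
    have hstep : n k * (∑ l ∈ S.filter (fun l => ε ≤ |(topCnt 3 l.tail : ℝ) / n k - θ|), wD 3 (stripYT 3) l) / hatD 3 (stripYT 3) k a b
        ≤ n k * (hatD 3 (stripYT 3) k a b * varTopThree k a b / ((ε - |β k|) * n k) ^ 2) / hatD 3 (stripYT 3) k a b := by
      refine div_le_div_of_nonneg_right (mul_le_mul_of_nonneg_left (hmono.trans hcheb) h3.le) hD.le
    refine hstep.trans (le_of_eq ?_)
    field_simp
  exact hkey.trans h1.le

end W3

end HV

end Literature.Probability.RandomPlanarGeometry.SAW
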